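import Summits.Parity.GeneralizedHardyLittlewood.Theorems.PrimeLevelFamEdgeIdeaDeltasBarrierDefs
import Literature.NumberTheory.LFunctions.KloostermanQuadraticTwist
import HarnessLib

/-!
# Route `PrimeLevelFamEdge` — TYPED IDEA DELTAS, deck 20b: lens-18 «complete» × U-d, §2 K-L18-3 «KMS'S OWN NAMED
# COMPLETION IS A CORNER» (the codimension ladder of Kowalski–Michel–Sawin 2017 p. 11, proved arithmetic) and §3
# the typed DEAD residual of A-L18-1 (affine Estermann decorrelation, Prop only) (cell ls-idea, seat ls-idea-lens-18;
# critic E b3 PASS; LANDING NOTE typer ls-idea-typ-1 gen 2: §2–§3 of the seat's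
# `Sketch_Lens18_KloostermanMeanSquare.lean` sha16 2045d251c2eb0480 VERBATIM up to the namespace (`LsIdea.Lens18` →
# the deck namespace `.KMSCorner`) plus critic E's `kmsCodimRange_le_five_quarters`; §1 is deck 20a
# `PrimeLevelFamEdgeIdeaDeltasKloostermanMeanSquare.lean`.)

HONESTY: exponent bookkeeping and typed Props; nothing here asserts or proves `MomentsBeyondDiagonal` (K_A),
`BeyondDiagonalBeatsQuarter` (K_B), any moment asymptotic, or any exceptional-zero statement; typed ≠ proved.
-/

noncomputable section

open Finset

/-! ## §2  K-L18-3 — the codimension ladder of KMS17 p.11 (proved arithmetic)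

Kowalski–Michel–Sawin (arXiv:1511.01636, p.11): if the bad locus `V_l^{bad}` had codimension `≥ 2`
one could take `l = 5` and reach `MN ≥ q^{5/6+δ}`; with the best possible codimension `l` the
non-trivial range would be `MN ≥ q^{(3l+5)/(4(l+1))+δ}`, whose limit is `3/4`.  Every rung of this
author-named ladder lies inside `M, N < q` (benchmark = trivial bound, Theorem 1.1's window
`MN < q^{5/4}`), whereas the door's type-II block has total length `q^{2+η}`, `η = Δ′ − 1 > 0`
(`bulk_outside_kms_window`).  So the programme's own completion is a CORNER move (small-conductor /
short-range side of BN-7), not an input for `MomentsBeyondDiagonal`. -/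

namespace Summit.Parity.GeneralizedHardyLittlewood.Theorems.PrimeLevelFamEdgeIdeaDeltas.KMSCorner

/-- KMS's hypothetical non-trivial range exponent with best-possible codimension `l`:
`r(l) = (3l+5)/(4(l+1))`. [cite: KowalskiMichelSawin2017, p.11 (codimension remark after Thm 1.3)] -/
def kmsCodimRange (l : ℕ) : ℝ := (3 * l + 5) / (4 * (l + 1))

/-- Closed form `r(l) = 3/4 + 1/(2(l+1))`. [cite: KowalskiMichelSawin2017, p.11] -/
theorem kmsCodimRange_eq (l : ℕ) : kmsCodimRange l = 3 / 4 + 1 / (2 * ((l : ℝ) + 1)) := by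
  unfold kmsCodimRange
  have : (0 : ℝ) < (l : ℝ) + 1 := by positivity
  field_simp
  ring

/-- The rung the authors name explicitly: `l = 5` gives `MN ≥ q^{5/6+δ}`. [cite: KowalskiMichelSawin2017, p.11] -/
theorem kmsCodimRange_five : kmsCodimRange 5 = 5 / 6 := by
  unfold kmsCodimRange; norm_num

/-- Every rung is above `3/4` (the ladder's limit) … [folklore] -/
theorem three_quarters_lt_kmsCodimRange (l : ℕ) : 3 / 4 < kmsCodimRange l := by
  rw [kmsCodimRange_eq]
  have : (0 : ℝ) < 1 / (2 * ((l : ℝ) + 1)) := by positivity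
  linarith

/-- … and the ladder is strictly decreasing. [folklore] -/
theorem kmsCodimRange_strictAnti : StrictAnti kmsCodimRange := by
  intro l l' h
  rw [kmsCodimRange_eq, kmsCodimRange_eq]
  have hl : (0 : ℝ) < (l : ℝ) + 1 := by positivity
  have hll : (l : ℝ) + 1 < (l' : ℝ) + 1 := by exact_mod_cast Nat.succ_lt_succ h
  have : 1 / (2 * ((l' : ℝ) + 1)) < 1 / (2 * ((l : ℝ) + 1)) := by
    apply one_div_lt_one_div_of_lt <;> nlinarith
  linarith

/-- Placement: every rung `r(l) ≤ 5/4 < 2 + η` for `η > −3/4` — all of the codimension ladder, like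
Theorem 1.1's window, sits below the door's block length `q^{2+η}` (cf. `bulk_outside_kms_window`). [folklore] -/
theorem kmsCodimRange_lt_door (l : ℕ) (η : ℝ) (hη : -3 / 4 < η) : kmsCodimRange l < 2 + η := by
  rw [kmsCodimRange_eq]
  have hl : (1 : ℝ) ≤ (l : ℝ) + 1 := by
    have : (0 : ℝ) ≤ (l : ℝ) := by positivity
    linarith
  have : 1 / (2 * ((l : ℝ) + 1)) ≤ 1 / 2 := by
    rw [div_le_div_iff₀ (by positivity) (by norm_num)]
    linarith
  linarith

/-- Critic E (REF-E b3; K-L18-3 ruler vs KMS Thm 1.1's own window): the whole codimension ladder sits below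
`5/4`, the upper end of Theorem 1.1's range `q^{1/4} < MN < q^{5/4}` [KMS17 p.3]. -/
theorem kmsCodimRange_le_five_quarters (l : ℕ) : kmsCodimRange l ≤ 5 / 4 := by
  rw [kmsCodimRange_eq]
  have hl : (1 : ℝ) ≤ (l : ℝ) + 1 := by
    have : (0 : ℝ) ≤ (l : ℝ) := by positivity
    linarith
  have : 1 / (2 * ((l : ℝ) + 1)) ≤ 1 / 2 := by
    rw [div_le_div_iff₀ (by positivity) (by norm_num)]
    linarith
  linarith

end Summit.Parity.GeneralizedHardyLittlewood.Theorems.PrimeLevelFamEdgeIdeaDeltas.KMSCorner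

/-! ## §3  The Möbius-free residual lemma of the Heath-Brown / Type-II arrangement on the LONG variable
(card row A-L18-1; CONJECTURE SHAPE typed so that it can be cited — and REFUTED IN SUBSTANCE by this seat's
own cheapest falsifier, see the card §D R2 and `HOME/ls-idea-lens-18/numerics.log`).

`F_q(x) := E_q(x⁻¹)`, `E_q(y) := ∑_{n ≤ N} τ(n) n^{-1/2} e^{-n/q} e(ny/q)` (the Estermann table read through
inversion); its additive Fourier transform is the kernel `K(u) = ∑_n b_n S(u,n;q)` of the `c = q` term.
After Heath-Brown on the long variable `m = d₁d₂` and Cauchy–Schwarz in a factor `r₁ ∈ [q^{1/2+η+ε}, q^{1-ε}]`,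
the complete (`t = 0`) terms are evaluated EXACTLY by §1 and the only input left would be a power saving `δ > η`
in the AFFINE correlations `∑_x F♭(x) conj(F♭((c x - t)/c'))`, `t ≠ 0`.  MEASURED (pure python, q ≤ 8009):
relative to its own diagonal the `(c,c',t) = (1,1,1)` correlation is 0.39 (unflattened, q-independent) and
0.24 / 0.20 / 0.15 / 0.17 at q = 1009 / 2003 / 4001 / 8009 after removing heights `≤ q^{1/4}` — a CONSTANT
fraction, not `q^{-δ}`.  MECHANISM: Voronoi mod q makes `K(u) ≈ q·τ(u)u^{-1/2}g(u/q)`, so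
`∑_u |K(u)|² e(-tu/q) / ∑_u |K|² ≈ (1 - log t / log q)^4`-type decay only; summed over `|t| ≲ q/R₁` the
`t ≠ 0` terms return the full completion loss `q/R₁`: the arrangement sits at BN-7a's threshold like every other.
So `AffineEstermannDecorrelation δ A` is expected FALSE for every `δ > 0` (not proved false here: typed ≠ proved,
computed ≠ proved). [conjecture-shape, refuted numerically — this note; cf. Bettin arXiv:1701.06601 §1.1] -/

namespace Summit.Parity.GeneralizedHardyLittlewood.Theorems.PrimeLevelFamEdgeIdeaDeltas.KMSCorner

open Literature.NumberTheory.LFunctions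

/-- The folded divisor table `b_k = ∑_{n ≡ k (q), 1 ≤ n ≤ N, q ∤ n} τ(n) n^{-1/2} e^{-n/q}`. -/
noncomputable def divTable (q N : ℕ) (k : ZMod q) : ℝ :=
  ∑ n ∈ Finset.Icc 1 N,
    if (n : ZMod q) = k ∧ (n : ZMod q) ≠ 0 then
      ((Nat.divisors n).card : ℝ) * (n : ℝ) ^ (-(1 / 2 : ℝ)) * Real.exp (-(n : ℝ) / q)
    else 0

/-- The Estermann table `E_q(y) = ∑_k b_k e(ky/q)`. -/
noncomputable def estermannTable (q N : ℕ) [NeZero q] (y : ZMod q) : ℂ :=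
  ∑ k : ZMod q, (divTable q N k : ℂ) * (ZMod.stdAddChar (k * y) : ℂ)

/-- `F_q(x) = E_q(x⁻¹)` (and `0` at `x = 0`). -/
noncomputable def invEstermann (q N : ℕ) [NeZero q] (x : ZMod q) : ℂ :=
  if IsUnit x then estermannTable q N x⁻¹ else 0

/-- `x` has height `≤ H`: `c x ≡ d (mod q)` for some integers `1 ≤ c ≤ H`, `|d| ≤ H` (the major arcs). -/
def SmallHeight (q : ℕ) (H : ℕ) (x : ZMod q) : Prop :=
  ∃ c d : ℤ, 1 ≤ c ∧ c ≤ H ∧ |d| ≤ H ∧ (c : ZMod q) * x = (d : ZMod q)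

/-- The flattened table `F♭ = F · 1[height > H]`. -/
noncomputable def invEstermannFlat (q N H : ℕ) [NeZero q] (x : ZMod q) : ℂ :=
  by classical exact if SmallHeight q H x then 0 else invEstermann q N x

/-- Affine correlation `∑_x F♭(x) conj(F♭((c x - t) c'⁻¹))`. -/
noncomputable def affineCorr (q N H : ℕ) [NeZero q] (c c' t : ZMod q) : ℂ :=
  ∑ x : ZMod q, invEstermannFlat q N H x *
    (starRingEnd ℂ) (invEstermannFlat q N H ((c * x - t) * c'⁻¹))

/-- AFFINE DECORRELATION OF THE (FLATTENED) ESTERMANN TABLE with saving `δ` (the residual lemma of the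
Heath-Brown/Type-II arrangement on the long variable; row A-L18-1): for all large primes `q`, with `N = 8q` and
major arcs of height `≤ (log q)^A` removed, every affine correlation with `t ≠ 0` and `c, c'` of height `≤ √q`
is at most `C q^{-δ} · ∑_x ‖F(x)‖²`.  The arrangement would consume it with any `δ > η` at `Δ' = 1 + η`;
this seat's numerics (q ≤ 8009) and the Voronoi-duality mechanism say it FAILS for every `δ > 0`
(relative size ≈ 0.15–0.2 at `t = 1`, q-independent).  Typed to be citable as a dead line, not as a lever.
[conjecture-shape, numerically refuted — this note] -/
def AffineEstermannDecorrelation (δ A : ℝ) : Prop :=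
  ∃ C q₀ : ℝ, ∀ q : ℕ, ∀ _ : Fact q.Prime, q₀ ≤ q →
    ∀ c c' t : ZMod q, t ≠ 0 → c ≠ 0 → c' ≠ 0 →
      (c.val : ℝ) ≤ Real.sqrt q → (c'.val : ℝ) ≤ Real.sqrt q →
        ‖affineCorr q (8 * q) ⌈Real.log q ^ A⌉₊ c c' t‖ ≤
          C * (q : ℝ) ^ (-δ) * ∑ x : ZMod q, ‖invEstermann q (8 * q) x‖ ^ 2

/-- Sanity: the statement is monotone in the saving (a larger saving implies a smaller one). [folklore] -/
theorem AffineEstermannDecorrelation.mono {δ δ' A : ℝ} (h : δ' ≤ δ)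
    (H : AffineEstermannDecorrelation δ A) : AffineEstermannDecorrelation δ' A := by
  obtain ⟨C, q₀, hC⟩ := H
  refine ⟨max C 0, max q₀ 1, fun q hq hq₀ c c' t ht hc hc' hcv hc'v => ?_⟩
  have hq1 : (1 : ℝ) ≤ q := le_trans (le_max_right _ _) hq₀
  have key := hC q hq (le_trans (le_max_left _ _) hq₀) c c' t ht hc hc' hcv hc'v
  have hS : 0 ≤ ∑ x : ZMod q, ‖invEstermann q (8 * q) x‖ ^ 2 :=
    Finset.sum_nonneg fun _ _ => by positivity
  have hq : 0 ≤ (q : ℝ) ^ (-δ) := by positivity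
  calc ‖affineCorr q (8 * q) ⌈Real.log q ^ A⌉₊ c c' t‖
      ≤ C * (q : ℝ) ^ (-δ) * ∑ x : ZMod q, ‖invEstermann q (8 * q) x‖ ^ 2 := key
    _ ≤ max C 0 * (q : ℝ) ^ (-δ) * ∑ x : ZMod q, ‖invEstermann q (8 * q) x‖ ^ 2 :=
        mul_le_mul_of_nonneg_right (mul_le_mul_of_nonneg_right (le_max_left _ _) hq) hS
    _ ≤ max C 0 * (q : ℝ) ^ (-δ') * ∑ x : ZMod q, ‖invEstermann q (8 * q) x‖ ^ 2 :=
        mul_le_mul_of_nonneg_right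
          (mul_le_mul_of_nonneg_left (Real.rpow_le_rpow_of_exponent_le hq1 (by linarith))
            (le_max_right _ _)) hS

end Summit.Parity.GeneralizedHardyLittlewood.Theorems.PrimeLevelFamEdgeIdeaDeltas.KMSCorner

/-! ## §4  A-L18-8 «ONE GRH BUDGET LINE ν ↔ Δ′+1» — typed exponent bookkeeping (BOOKKEEPING grade; seat ls-idea-lens-18
successor g0, cards §R4; `Sketch_L18g0_GRHBudget.lean` sha16 ef93ad0480d45f0d; LANDED VERBATIM by typer ls-idea-typ-1
gen 3 up to the namespace and added docstrings).  At the `c = q` Petersson term of a prime-level family, with Bessel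
argument `X = 4π√(ab)/q ≤ 1`, character-carrying variables of total logarithmic length `λ` contribute, relative to the
diagonal main term, `q^(weilRelExp λ + o(1))` under Weil's bound termwise and `q^(sqrtRelExp λ + o(1))` under
square-root cancellation per character (pointwise GRH / completion).  ILS one-level density with support `ν`: `λ = ν`;
KMV mollified harmonic second moment at `Δ′`: `λ = Δ′ + 1`.  Calibration points in print: Weil termwise ⇒ `Δ′ < 1/2`
(KMV 2000 p. 13); Lemma 3.3 ⇒ `Δ′ < 1`; GRH ⇒ support `ν < 2` (ILS 2000 Thm 1.1); `Δ′ = 1⁺` ⇒ exponent `0` = THRESHOLD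
(barrier-notes BN-7a b58).  For `λ > 2` (`X > 1`) the template is void.  NOTHING here is a theorem about
`L`-functions: exponent identities only; no summit statement, no exceptional-zero statement is proved or approached. -/

namespace Summit.Parity.GeneralizedHardyLittlewood.Theorems.PrimeLevelFamEdgeIdeaDeltas.KMSCorner

/-- relative exponent of the `c = q` term under Weil's bound termwise, total length exponent `l`. -/
def weilRelExp (l : ℝ) : ℝ := l - 3 / 2

/-- relative exponent under square-root cancellation per character (pointwise GRH / completion). -/
def sqrtRelExp (l : ℝ) : ℝ := l / 2 - 1

/-- total character-carrying length exponent of the ILS one-level density with support `ν`. -/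
def densityLength (ν : ℝ) : ℝ := ν

/-- total length exponent of the mollified harmonic second moment, mollifier-squared of length `q^Δ'`
(the `+ 1` is the divisor variable `n ≤ q^(1+ε)` of `L(1/2,f)^2`). -/
def secondMomentLength (Δ' : ℝ) : ℝ := Δ' + 1

/-- Weil termwise wins iff the total length is `< 3/2`. -/
theorem weilRelExp_neg_iff (l : ℝ) : weilRelExp l < 0 ↔ l < 3 / 2 := by
  unfold weilRelExp; constructor <;> intro h <;> linarith

/-- Square-root cancellation wins iff the total length is `< 2`. -/
theorem sqrtRelExp_neg_iff (l : ℝ) : sqrtRelExp l < 0 ↔ l < 2 := by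
  unfold sqrtRelExp; constructor <;> intro h <;> linarith

/-- KMV 2000 p.13: Weil termwise gives the mollified second moment only for `Δ′ < 1/2`. -/
theorem weil_secondMoment_iff (Δ' : ℝ) :
    weilRelExp (secondMomentLength Δ') < 0 ↔ Δ' < 1 / 2 := by
  unfold weilRelExp secondMomentLength; constructor <;> intro h <;> linarith

/-- Weil termwise gives the one-level density for support `ν < 3/2`. -/
theorem weil_density_iff (ν : ℝ) : weilRelExp (densityLength ν) < 0 ↔ ν < 3 / 2 := by
  unfold weilRelExp densityLength; constructor <;> intro h <;> linarith

/-- ILS Thm 1.1 (GRH): one-level density for support `ν < 2`. -/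
theorem sqrt_density_iff (ν : ℝ) : sqrtRelExp (densityLength ν) < 0 ↔ ν < 2 := by
  unfold sqrtRelExp densityLength; constructor <;> intro h <;> linarith

/-- KMV Lemma 3.3 range = pointwise-GRH range for the second moment at `c = q`: `Δ′ < 1`.
Pointwise GRH adds nothing to Lemma 3.3 here. -/
theorem sqrt_secondMoment_iff (Δ' : ℝ) :
    sqrtRelExp (secondMomentLength Δ') < 0 ↔ Δ' < 1 := by
  unfold sqrtRelExp secondMomentLength; constructor <;> intro h <;> linarith

/-- THRESHOLD: at `Δ′ = 1` the square-root-cancellation exponent is exactly `0` (b58: `MAIN·q^{o(1)}`). -/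
theorem sqrt_secondMoment_threshold (Δ' : ℝ) :
    sqrtRelExp (secondMomentLength Δ') = 0 ↔ Δ' = 1 := by
  unfold sqrtRelExp secondMomentLength; constructor <;> intro h <;> linarith

/-- THE DICTIONARY: the mollified second moment at `Δ′` and the one-level density at support
`ν = Δ′ + 1` sit at the same point of the GRH budget line (the second `L`-factor costs one unit). -/
theorem dictionary (Δ' : ℝ) :
    sqrtRelExp (secondMomentLength Δ') = sqrtRelExp (densityLength (Δ' + 1)) := rfl

/-- One unit of support, spelled out: the density's GRH-only window `1 < ν < 2` (beyond the
diagonal, where ILS get 9/16) is exactly the image `ν = Δ′ + 1` of the second moment's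
UNCONDITIONAL window `0 < Δ′ < 1`; the second moment's own beyond-diagonal zone `Δ′ > 1`
maps to `ν > 2`, outside every pointwise budget. -/
theorem one_unit_of_support (Δ' : ℝ) :
    (1 < densityLength (Δ' + 1) ∧ densityLength (Δ' + 1) < 2 ↔ 0 < Δ' ∧ Δ' < 1) ∧
    (2 < densityLength (Δ' + 1) ↔ 1 < Δ') := by
  unfold densityLength
  refine ⟨⟨fun h => ⟨by linarith [h.1], by linarith [h.2]⟩, fun h => ⟨by linarith [h.1], by linarith [h.2]⟩⟩,
    ⟨fun h => by linarith, fun h => by linarith⟩⟩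

/-- Gap between the two inputs on the second moment: Weil `1/2`, √-cancellation `1`; neither passes `1`. -/
theorem secondMoment_reaches (Δ' : ℝ) (h : 1 ≤ Δ') :
    ¬ weilRelExp (secondMomentLength Δ') < 0 ∧ ¬ sqrtRelExp (secondMomentLength Δ') < 0 := by
  rw [weil_secondMoment_iff, sqrt_secondMoment_iff]; constructor <;> intro h' <;> linarith

end Summit.Parity.GeneralizedHardyLittlewood.Theorems.PrimeLevelFamEdgeIdeaDeltas.KMSCorner
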